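import Literature.NumberTheory.EllipticCurves.BSDSha
import HarnessLib

/-!
# The order of a finite `Ш(E/K)` is a square: Silverman AEC Thm. X.4.14 "in particular" (= Cor. C.17.2.1)

`Proofs` companion of `Literature/NumberTheory/EllipticCurves/BSDSha.lean` for the *corollary clause*
of its named fact `WeierstrassCurve.exists_casselsTate_pairing` (bsd.S18; Cassels 1962; Silverman,
*The Arithmetic of Elliptic Curves*, 2nd ed., Thm. X.4.14, p. 341: "In particular, if `Ш(E/K)` is
finite, then its order is a perfect square (see Exercise 10.20)"; App. C, Thm. 17.2 and Cor. 17.2.1,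
p. 453).

Merge record (D-0026 review-split, 2026-08-15). The clause used to be carried by two further named
facts of `BSDSha.lean`, `WeierstrassCurve.isSquare_card_sha_of_finite`
(`∀ W [W.IsElliptic] [Finite W.sha], IsSquare (Nat.card W.sha)`) and its `shaOrder` phrasing
`WeierstrassCurve.isSquare_shaOrder`. In the source the clause is a *corollary* of the pairing
theorem (Cor. 17.2.1 of Thm. 17.2), and the corollary step is proved below in full; the only input
that is not formal is the pairing itself, i.e. exactly the parent fact `exists_casselsTate_pairing`
(Tate local duality and global duality, not in Mathlib). A corollary that carries the whole hard core
of its parent is not a separate debt, so both facts are merged back into the parent's obligation: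
this file no longer refers to either `def`, and states the clause directly as theorems *conditional on*
`exists_casselsTate_pairing` — the form in which every consumer of the pairing in the tree takes it
(`(hCT : exists_casselsTate_pairing)`, cf. `CasselsTateParity`, `BSDRankZeroDensityProofs`). The day
`exists_casselsTate_pairing_holds` lands, `isSquare_card_sha_of_finite_of_casselsTate
exists_casselsTate_pairing_holds` is the unconditional theorem, verbatim.

Silverman's architecture (X.4.14 and its proof sketch): (1) the Cassels–Tate pairing
`Ш × Ш → ℚ/ℤ` exists, is alternating, and its kernel on each side is the subgroup of divisible
elements (Cassels [38], Tate [281]) — the named fact `WeierstrassCurve.exists_casselsTate_pairing`;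
(2) "In particular, if `Ш(E/K)` is finite, then its order is a perfect square (see Exercise 10.20)":
a finite abelian group carrying a bilinear, alternating, nondegenerate `ℚ/ℤ`-valued pairing has
square order.

This file records, sorry-free:

* `WeierstrassCurve.isSquare_shaOrder_iff`, `WeierstrassCurve.isSquare_shaOrder_of`: the two
  phrasings of the clause — with the predicate `ShaFinite`/the number `shaOrder` of `Sha.lean`, and
  with `Finite`/`Nat.card` — are equivalent, definitionally (`ShaFinite W := Finite W.sha`,
  `shaOrder W := Nat.card W.sha`).
* `Literature.NumberTheory.EllipticCurves.isSquare_natCard_of_alternating_addCircle`: Exercise 10.20 —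
  a finite abelian group with a bi-additive alternating pairing into `ℚ/ℤ = AddCircle (1 : ℚ)` with
  trivial kernel has square order (proved for any target group in which an element of order `m`
  generates the `m`-torsion, `isSquare_natCard_of_alternating`);
* `Literature.NumberTheory.EllipticCurves.divisibleElements_eq_bot_of_finite`: a finite abelian group
  has no nonzero divisible element;
* `WeierstrassCurve.isSquare_card_sha_of_finite_of_casselsTate`: **the clause itself** —
  `exists_casselsTate_pairing → ∀ W [W.IsElliptic] [Finite W.sha], IsSquare (Nat.card W.sha)` — and
  `WeierstrassCurve.isSquare_shaOrder_of_casselsTate` (the same in the `shaOrder` phrasing: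
  `exists_casselsTate_pairing → ∀ W [W.IsElliptic], W.ShaFinite → IsSquare W.shaOrder`).

What is NOT here: the pairing (`exists_casselsTate_pairing_holds`), which is exactly Cassels' theorem;
its elementary half and its level-wise reformulation are in `BSDShaCasselsTateKernelProofs`. The
`p`-primary clause of X.4.14 ("the same is true of any `p`-primary component") is not vendored here
(cf. `CasselsTateParity` for the parity of the `p`-rank).

## References

* [SilvermanAEC2009] J. H. Silverman, *The Arithmetic of Elliptic Curves*, 2nd ed., GTM 106,
  Springer 2009: X.§4, Conj. 4.13, Thm. 4.14 (p. 341); Exercise 10.20; App. C §17, Thm. 17.2 and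
  Cor. 17.2.1 (p. 453).
* [Cassels1962ArithmeticIV] J. W. S. Cassels, *Arithmetic on curves of genus 1. IV. Proof of the
  Hauptvermutung*, J. reine angew. Math. 211 (1962), 95–112.
-/

noncomputable section

universe u

namespace WeierstrassCurve

open Literature.NumberTheory.EllipticCurves

variable {K : Type u} [Field K] [NumberField K]

/-- The two phrasings of Silverman, *AEC*, Thm. X.4.14 "in particular" (= App. C, Cor. 17.2.1)
are equivalent: "`Ш(E/K)` finite ⇒ `shaOrder E/K = #Ш(E/K)` is a square" (with the predicate
`ShaFinite` and the number `shaOrder` of `Sha.lean`; formerly the named fact `isSquare_shaOrder`) and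
"`Ш(E/K)` finite ⇒ `Nat.card Ш(E/K)` is a square" (formerly the named fact
`isSquare_card_sha_of_finite`; both merged into `exists_casselsTate_pairing` under D-0026, see the
module docstring): `W.ShaFinite` is `Finite W.sha` and `W.shaOrder` is `Nat.card W.sha` by
definition. [cite: SilvermanAEC2009, Thm. X.4.14] -/
theorem isSquare_shaOrder_iff :
    (∀ (W : WeierstrassCurve K) [W.IsElliptic], W.ShaFinite → IsSquare W.shaOrder) ↔
      ∀ (W : WeierstrassCurve K) [W.IsElliptic] [Finite W.sha], IsSquare (Nat.card W.sha) := by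
  constructor
  · intro h W _ hfin
    exact h W hfin
  · intro h W _ hfin
    haveI : Finite W.sha := hfin
    exact h W

/-- From the `Nat.card` phrasing of Silverman, *AEC*, Thm. X.4.14 "in particular" (= App. C,
Cor. 17.2.1) to its `shaOrder` phrasing: if `#Ш` is a square for every elliptic `W/K` with `Ш`
finite, then `W.ShaFinite → IsSquare W.shaOrder`; the converse direction is `isSquare_shaOrder_iff`.
[cite: SilvermanAEC2009, Thm. X.4.14] -/
theorem isSquare_shaOrder_of
    (h : ∀ (W : WeierstrassCurve K) [W.IsElliptic] [Finite W.sha], IsSquare (Nat.card W.sha))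
    (W : WeierstrassCurve K) [W.IsElliptic] (hW : W.ShaFinite) : IsSquare W.shaOrder :=
  (isSquare_shaOrder_iff (K := K)).mpr h W hW

end WeierstrassCurve

/-! ## Exercise 10.20 and the reduction to the Cassels–Tate pairing

Silverman, *AEC* (2nd ed.), X.§4, Theorem 4.14 (Cassels [38] = *Arithmetic on curves of genus 1, IV*,
J. reine angew. Math. 211 (1962); Tate [281] = *Duality theorems in Galois cohomology over number
fields*, Proc. ICM Stockholm 1962): for an elliptic curve `E/K` over a number field there is an
alternating bilinear pairing `Γ : Ш(E/K) × Ш(E/K) → ℚ/ℤ` whose kernel on each side is exactly the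
subgroup of divisible elements of `Ш(E/K)`; "in particular, if `Ш(E/K)` is finite, then its order is a
perfect square (see Exercise 10.20)". Exercise 10.20: a finite abelian group carrying a bilinear,
alternating, nondegenerate `ℚ/ℤ`-valued pairing has square order.

The printed proof of the clause "finite `Ш(E/K)` has square order" therefore has exactly two
ingredients:
(1) the Cassels–Tate pairing — the named fact `WeierstrassCurve.exists_casselsTate_pairing` of
`BSDSha.lean` (Tate local and global duality for `H¹_cont(Γ_K, E(K̄))`, not in reach of Mathlib), and
(2) the finite-group algebra of Exercise 10.20 together with "a finite group has no nonzero divisible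
element". Ingredient (2) is proved here in full; no new named fact is introduced (D-0026).

`isSquare_natCard_of_alternating`: let `A` be a finite abelian group and `B : A →+ A →+ C` bi-additive
with `B a a = 0` and trivial left kernel, where in the target group `C` an element of order `m`
generates all of the `m`-torsion (true for `C = ℚ/ℤ = AddCircle (1 : ℚ)`:
`addCircle_mem_zmultiples_of_addOrderOf_eq`, from Mathlib's bound
`AddCircle.card_torsion_le_of_isSMulRegular` on the `m`-torsion of `AddCircle`). Then `#A` is a square.
Proof by strong induction on `#A`: for `x ≠ 0` put `χ = B x`, `H = ker χ ∋ x`; the image of `χ` is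
cyclic, generated by some `χ y₀` (exponent argument), and nondegeneracy forces
`ord x = ord (χ y₀) = #χ(A) =: m ≥ 2`; every character `B a` (`a ∈ H`) vanishing on `H` is an integer
multiple of `χ` (`exists_eq_zsmul_of_ker_le`), whence the pairing induced on `H / ℤx` is again
alternating with trivial kernel; finally `#A = #χ(A) · #H = m · (#(H/ℤx) · m)` and the induction
hypothesis applies to `H / ℤx`. (Some hypothesis on `C` is needed: `(a, b) ↦ a ∧ b` on `A = 𝔽₂³` with
values in `Λ²A ≅ 𝔽₂³` is alternating with trivial kernel, and `#A = 8`.)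
-/

universe v

namespace Literature.NumberTheory.EllipticCurves

section SquareOrder

variable {C : Type*} [AddCommGroup C]

/-- An alternating bi-additive map is antisymmetric: `B b a = - B a b` (expand `B (a + b) (a + b) = 0`).
[folklore] -/
theorem pairing_swap_eq_neg {A : Type*} [AddCommGroup A] (B : A →+ A →+ C)
    (halt : ∀ a, B a a = 0) (a b : A) : B b a = -B a b := by
  have h := halt (a + b)
  simp only [map_add, AddMonoidHom.add_apply, halt, zero_add, add_zero] at h
  rw [eq_neg_iff_add_eq_zero]
  exact h

/-- In `ℚ/ℤ = AddCircle (1 : ℚ)` an element `u` of order `m` generates the whole `m`-torsion: if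
`m • w = 0` then `w ∈ ℤ u`. (The `m`-torsion of `AddCircle` has at most `m` elements, Mathlib's
`AddCircle.card_torsion_le_of_isSMulRegular`, and `ℤ u` already has `m`.) [folklore] -/
theorem addCircle_mem_zmultiples_of_addOrderOf_eq (m : ℕ) (hm : 0 < m) (u w : AddCircle (1 : ℚ))
    (hu : addOrderOf u = m) (hw : m • w = 0) : w ∈ AddSubgroup.zmultiples u := by
  have hreg : IsSMulRegular ℚ m := by
    intro a b hab
    simp only [nsmul_eq_mul] at hab
    exact mul_left_cancel₀ (by exact_mod_cast hm.ne') hab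
  have hT : {x : AddCircle (1 : ℚ) | m • x = 0}.encard ≤ m :=
    AddCircle.card_torsion_le_of_isSMulRegular 1 m hm.ne' hreg
  set S : Set (AddCircle (1 : ℚ)) := (AddSubgroup.zmultiples u : Set (AddCircle (1 : ℚ))) with hS_def
  have hsub : S ⊆ {x : AddCircle (1 : ℚ) | m • x = 0} := by
    intro x hx
    obtain ⟨k, rfl⟩ := AddSubgroup.mem_zmultiples_iff.mp hx
    show m • k • u = 0
    rw [← hu, smul_comm, addOrderOf_nsmul_eq_zero, smul_zero]
  have hfinS : S.Finite := finite_zmultiples.mpr (addOrderOf_pos_iff.mp (hu ▸ hm))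
  have hS : S.encard = m := by
    rw [← hfinS.cast_ncard_eq, ← Nat.card_coe_set_eq, hS_def, SetLike.coe_sort_coe,
      Nat.card_zmultiples, hu]
  have hST : S = {x : AddCircle (1 : ℚ) | m • x = 0} :=
    (Set.finite_of_encard_le_coe hT).eq_of_subset_of_encard_le' hsub (hS ▸ hT)
  have hwS : w ∈ S := by rw [hST]; exact hw
  exact hwS

variable (hC : ∀ m : ℕ, 0 < m → ∀ u w : C, addOrderOf u = m → m • w = 0 →
  w ∈ AddSubgroup.zmultiples u)
include hC

/-- If every element of order `m` of `C` generates the `m`-torsion of `C`, then the image of a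
homomorphism `χ : A →+ C` from a finite abelian group is cyclic, generated by some value `χ y₀`
(take `χ y₀` of order the exponent of `χ(A)`). [folklore] -/
theorem exists_forall_mem_zmultiples {A : Type*} [AddCommGroup A] [Finite A] (χ : A →+ C) :
    ∃ y₀ : A, addOrderOf (χ y₀) = AddMonoid.exponent χ.range ∧
      ∀ b, χ b ∈ AddSubgroup.zmultiples (χ y₀) := by
  haveI : Finite χ.range := Finite.of_surjective χ.rangeRestrict χ.rangeRestrict_surjective
  obtain ⟨u, hu⟩ :=
    AddMonoid.exists_addOrderOf_eq_exponent (G := χ.range) AddMonoid.ExponentExists.of_finite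
  have hm : 0 < AddMonoid.exponent χ.range :=
    Nat.pos_of_ne_zero AddMonoid.exponent_ne_zero_of_finite
  obtain ⟨y₀, hy₀⟩ := AddMonoidHom.mem_range.mp u.2
  have hord : addOrderOf (χ y₀) = AddMonoid.exponent χ.range := by
    rw [hy₀, AddSubgroup.addOrderOf_coe, hu]
  refine ⟨y₀, hord, fun b => hC _ hm _ _ hord ?_⟩
  have h := congrArg Subtype.val (AddMonoid.exponent_nsmul_eq_zero (⟨χ b, b, rfl⟩ : χ.range))
  simpa using h

/-- Key step of Exercise 10.20: for homomorphisms `χ ψ : A →+ C` out of a finite abelian group with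
`ker χ ≤ ker ψ`, and `C` as above (e.g. `ℚ/ℤ`), `ψ` is an integer multiple of `χ`. [folklore] -/
theorem exists_eq_zsmul_of_ker_le {A : Type*} [AddCommGroup A] [Finite A] (χ ψ : A →+ C)
    (hker : ∀ a, χ a = 0 → ψ a = 0) : ∃ j : ℤ, ∀ a, ψ a = j • χ a := by
  obtain ⟨y₀, hord, hy₀⟩ := exists_forall_mem_zmultiples hC χ
  set m := AddMonoid.exponent χ.range with hm_def
  haveI : Finite χ.range := Finite.of_surjective χ.rangeRestrict χ.rangeRestrict_surjective
  have hm : 0 < m := Nat.pos_of_ne_zero AddMonoid.exponent_ne_zero_of_finite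
  -- `ψ y₀` is `m`-torsion, hence a multiple of `χ y₀`
  have hψy₀ : m • ψ y₀ = 0 := by
    rw [← map_nsmul]
    apply hker
    rw [map_nsmul, ← hord, addOrderOf_nsmul_eq_zero]
  obtain ⟨j, hj⟩ := AddSubgroup.mem_zmultiples_iff.mp (hC m hm (χ y₀) (ψ y₀) hord hψy₀)
  refine ⟨j, fun a => ?_⟩
  obtain ⟨k, hk⟩ := AddSubgroup.mem_zmultiples_iff.mp (hy₀ a)
  have hka : ψ (a - k • y₀) = 0 := hker _ (by rw [map_sub, map_zsmul, hk, sub_self])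
  rw [map_sub, map_zsmul, sub_eq_zero] at hka
  rw [hka, ← hj, ← hk, smul_comm]

/-- **Silverman, *AEC*, Exercise 10.20** (the algebra behind "the order of a finite `Ш` is a square"),
by strong induction on the order: a finite abelian group `A` with a bi-additive pairing
`B : A →+ A →+ C` which is alternating (`B a a = 0`) and has trivial left kernel has square order,
provided every element of order `m` of `C` generates the `m`-torsion of `C` (as in `ℚ/ℤ`).
[cite: SilvermanAEC2009, Exercise 10.20 and Thm. X.4.14] -/
private theorem isSquare_of_natCard_eq (n : ℕ) :
    ∀ (A : Type v) [AddCommGroup A] [Finite A] (B : A →+ A →+ C), (∀ a, B a a = 0) →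
      (∀ a, (∀ b, B a b = 0) → a = 0) → Nat.card A = n → IsSquare n := by
  induction n using Nat.strong_induction_on with
  | _ n ih =>
  intro A _ _ B halt hnd hn
  rcases subsingleton_or_nontrivial A with hA | hA
  · have h1 : Nat.card A = 1 :=
      le_antisymm (Finite.card_le_one_iff_subsingleton.mpr hA) Nat.card_pos
    rw [← hn, h1]
    exact ⟨1, rfl⟩
  obtain ⟨x, hx⟩ := exists_ne (0 : A)
  have hanti : ∀ a b, B b a = -B a b := pairing_swap_eq_neg B halt
  -- the character `χ = B x`, its kernel `H ∋ x`, and a generator `χ y₀` of its image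
  set χ : A →+ C := B x with hχ_def
  set H : AddSubgroup A := χ.ker with hH_def
  have hxH : x ∈ H := by rw [hH_def, AddMonoidHom.mem_ker, hχ_def]; exact halt x
  obtain ⟨y₀, hord, hy₀⟩ := exists_forall_mem_zmultiples hC χ
  -- `ord x = ord (χ y₀)` by nondegeneracy
  set m : ℕ := addOrderOf x with hm_def
  have hm_pos : 0 < m := addOrderOf_pos x
  have hm_one : m ≠ 1 := by rwa [Ne, hm_def, AddMonoid.addOrderOf_eq_one_iff]
  have hm_two : 1 < m := by omega
  have hordx : addOrderOf (χ y₀) = m := by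
    rw [hm_def, addOrderOf_eq_addOrderOf_iff]
    intro k
    constructor
    · intro hk
      apply hnd
      intro b
      obtain ⟨l, hl⟩ := AddSubgroup.mem_zmultiples_iff.mp (hy₀ b)
      rw [map_nsmul, AddMonoidHom.nsmul_apply, ← hχ_def, ← hl, smul_comm, hk, smul_zero]
    · intro hk
      rw [hχ_def, ← AddMonoidHom.nsmul_apply, ← map_nsmul, hk, map_zero, AddMonoidHom.zero_apply]
  -- `#χ(A) = m`
  haveI : Finite χ.range := Finite.of_surjective χ.rangeRestrict χ.rangeRestrict_surjective
  have hrange : χ.range = AddSubgroup.zmultiples (χ y₀) := by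
    apply le_antisymm
    · rintro _ ⟨b, rfl⟩
      exact hy₀ b
    · exact AddSubgroup.zmultiples_le.mpr ⟨y₀, rfl⟩
  have hcard_range : Nat.card χ.range = m := by
    rw [hrange, Nat.card_zmultiples, hordx]
  -- the subquotient `A' = H / ℤx` and its cardinality
  set N : AddSubgroup H := AddSubgroup.zmultiples (⟨x, hxH⟩ : H) with hN_def
  haveI : Finite (H ⧸ N) := Finite.of_surjective _ (QuotientAddGroup.mk'_surjective N)
  have hcardN : Nat.card N = m := by
    rw [hN_def, Nat.card_zmultiples, AddSubgroup.addOrderOf_mk, hm_def]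
  have hcardA : Nat.card A = m * (Nat.card (H ⧸ N) * m) := by
    rw [AddSubgroup.card_eq_card_quotient_mul_card_addSubgroup H,
      Nat.card_congr (QuotientAddGroup.quotientKerEquivRange χ).toEquiv, hcard_range,
      AddSubgroup.card_eq_card_quotient_mul_card_addSubgroup N, hcardN]
  have hlt : Nat.card (H ⧸ N) < n := by
    rw [← hn, hcardA]
    have hpos : 0 < Nat.card (H ⧸ N) := Nat.card_pos
    have h1 : Nat.card (H ⧸ N) < Nat.card (H ⧸ N) * m := lt_mul_of_one_lt_right hpos hm_two
    exact lt_of_lt_of_le h1 (Nat.le_mul_of_pos_left _ hm_pos)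
  -- the induced pairing on `H / ℤx`
  have hBx : ∀ b : A, b ∈ H → B b x = 0 := fun b hb => by
    rw [hanti, neg_eq_zero]; exact hb
  have hfN : ∀ a : H, N ≤ ((B (a : A)).comp H.subtype).ker := fun a =>
    AddSubgroup.zmultiples_le.mpr (hBx a a.2)
  let g : H →+ (H ⧸ N →+ C) :=
    AddMonoidHom.mk' (fun a : H => QuotientAddGroup.lift N ((B (a : A)).comp H.subtype) (hfN a))
      (fun a b => QuotientAddGroup.addMonoidHom_ext N (by ext c; simp))
  have hg : ∀ (a b : H), g a (b : H ⧸ N) = B a b := fun a b => rfl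
  have hgN : N ≤ g.ker := by
    refine AddSubgroup.zmultiples_le.mpr ?_
    rw [AddMonoidHom.mem_ker]
    refine QuotientAddGroup.addMonoidHom_ext N ?_
    ext c
    simp only [AddMonoidHom.comp_apply, QuotientAddGroup.mk'_apply, hg, AddMonoidHom.zero_comp,
      AddMonoidHom.zero_apply]
    exact c.2
  let B' : (H ⧸ N) →+ (H ⧸ N) →+ C := QuotientAddGroup.lift N g hgN
  have hB' : ∀ a b : H, B' (a : H ⧸ N) (b : H ⧸ N) = B a b := fun a b => rfl
  have halt' : ∀ a, B' a a = 0 := fun a => by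
    induction a using QuotientAddGroup.induction_on with
    | H a => rw [hB']; exact halt a
  have hnd' : ∀ a, (∀ b, B' a b = 0) → a = 0 := by
    intro a ha
    induction a using QuotientAddGroup.induction_on with
    | H a =>
    rw [QuotientAddGroup.eq_zero_iff, hN_def, AddSubgroup.mem_zmultiples_iff]
    -- `B a` vanishes on `H = ker χ`, hence is a multiple `j • χ`, hence `a = j • x`
    obtain ⟨j, hj⟩ := exists_eq_zsmul_of_ker_le hC χ (B (a : A)) (fun c hc => by
      have := ha (⟨c, hc⟩ : H)
      rwa [hB'] at this)
    refine ⟨j, Subtype.ext ?_⟩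
    have hzero : (a : A) - j • x = 0 := by
      apply hnd
      intro b
      rw [map_sub, map_zsmul, AddMonoidHom.sub_apply, AddMonoidHom.zsmul_apply, hj b, hχ_def,
        sub_self]
    simp only [AddSubgroupClass.coe_zsmul]
    exact (sub_eq_zero.mp hzero).symm
  -- induction
  obtain ⟨r, hr⟩ := ih _ hlt (H ⧸ N) B' halt' hnd' rfl
  refine ⟨m * r, ?_⟩
  rw [← hn, hcardA, hr]
  ring

/-- **Silverman, *AEC*, Exercise 10.20**: a finite abelian group `A` with an alternating bi-additive
pairing `B : A →+ A →+ C` with trivial left kernel has square order, for any target group `C` in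
which an element of order `m` generates the `m`-torsion (e.g. `C = ℚ/ℤ`).
[cite: SilvermanAEC2009, Exercise 10.20 and Thm. X.4.14] -/
theorem isSquare_natCard_of_alternating (A : Type v) [AddCommGroup A] [Finite A]
    (B : A →+ A →+ C) (halt : ∀ a, B a a = 0) (hnd : ∀ a, (∀ b, B a b = 0) → a = 0) :
    IsSquare (Nat.card A) :=
  isSquare_of_natCard_eq hC (Nat.card A) A B halt hnd rfl

omit hC in
/-- The case `C = ℚ/ℤ = AddCircle (1 : ℚ)` of Exercise 10.20, as printed: a finite abelian group with
a bilinear, alternating, nondegenerate pairing `A × A → ℚ/ℤ` has square order.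
[cite: SilvermanAEC2009, Exercise 10.20] -/
theorem isSquare_natCard_of_alternating_addCircle (A : Type v) [AddCommGroup A] [Finite A]
    (B : A →+ A →+ AddCircle (1 : ℚ)) (halt : ∀ a, B a a = 0)
    (hnd : ∀ a, (∀ b, B a b = 0) → a = 0) : IsSquare (Nat.card A) :=
  isSquare_natCard_of_alternating addCircle_mem_zmultiples_of_addOrderOf_eq A B halt hnd

end SquareOrder

/-- A finite abelian group has no nonzero divisible element: `A_div = 0` (divide by `#A`).
Fuchs, *Infinite Abelian Groups*, §20. [folklore] -/
theorem divisibleElements_eq_bot_of_finite (A : Type*) [AddCommGroup A] [Finite A] :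
    AddSubgroup.divisibleElements A = ⊥ := by
  rw [eq_bot_iff]
  intro x hx
  obtain ⟨y, rfl⟩ := hx (Nat.card A) Nat.card_pos
  rw [AddSubgroup.mem_bot]
  exact card_nsmul_eq_zero'

end Literature.NumberTheory.EllipticCurves

namespace WeierstrassCurve

open Literature.NumberTheory.EllipticCurves

variable {K : Type u} [Field K] [NumberField K]

/-- **bsd.S18** (corollary clause: the order of a finite `Ш` is a square; Silverman, *AEC*,
Thm. X.4.14 "in particular" = App. C, Cor. 17.2.1; Cassels, J. reine angew. Math. 211 (1962); Tate,
Proc. ICM 1962; Milne, *ADT*, I.6.26). The Cassels–Tate pairing fact `exists_casselsTate_pairing`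
(alternating, kernel = divisible elements) implies that a finite `Ш(E/K)` has square order: a finite
group has no nonzero divisible element, so the pairing is nondegenerate, and Exercise 10.20 applies.
This theorem *is* the tree's form of the clause (the former named fact `isSquare_card_sha_of_finite`
was merged into `exists_casselsTate_pairing` under D-0026, see the module docstring); with
`exists_casselsTate_pairing_holds` it becomes unconditional. Deliberate dot-notation extension of
Mathlib's `WeierstrassCurve` namespace (as in `BSDSha.lean`).
[cite: SilvermanAEC2009, Thm. X.4.14 and Exercise 10.20] -/
theorem isSquare_card_sha_of_finite_of_casselsTate (h : exists_casselsTate_pairing (K := K))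
    (W : WeierstrassCurve K) [W.IsElliptic] [Finite W.sha] : IsSquare (Nat.card W.sha) := by
  obtain ⟨B, halt, hker⟩ := h W
  refine isSquare_natCard_of_alternating_addCircle W.sha B halt fun a ha => ?_
  have hmem : a ∈ AddSubgroup.divisibleElements W.sha := (hker a).mp ha
  rwa [divisibleElements_eq_bot_of_finite, AddSubgroup.mem_bot] at hmem

/-- **bsd.S18** (corollary clause, `shaOrder` phrasing): the Cassels–Tate pairing fact implies that
if `Ш(E/K)` is finite then `shaOrder E/K = #Ш(E/K)` is a perfect square (Silverman, *AEC*, Thm. X.4.14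
"in particular"; formerly the named fact `isSquare_shaOrder`, merged under D-0026). Deliberate
dot-notation extension of Mathlib's `WeierstrassCurve` namespace. [cite: SilvermanAEC2009, Thm. X.4.14] -/
theorem isSquare_shaOrder_of_casselsTate (h : exists_casselsTate_pairing (K := K))
    (W : WeierstrassCurve K) [W.IsElliptic] (hW : W.ShaFinite) : IsSquare W.shaOrder :=
  isSquare_shaOrder_of (fun W _ _ => isSquare_card_sha_of_finite_of_casselsTate h W) W hW

end WeierstrassCurve
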